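import Summits.BirchSwinnertonDyer.BirchSwinnertonDyer.Theorems.EisensteinPrimesGoodLatticeMuLambdaSplitDS
import Summits.BirchSwinnertonDyer.Rank1Residual.X1.KellerYinMuLambdaSplitDSFree
import HarnessLib

/-!
# Route `EisensteinPrimes` (rung K5), crux 2 `GoodLatticeBDPValue`, line `halves` v4: the CLASS-WIDE
# re-cut composition — `[ALG] + [AN]-DS-Free + [BRω]-DS-Free + [BR𝟙]-DS-Free ⟹ ∀ W p, GoodLatticeMuLambdaOnTree W p`
# and the crux BY NAME from four PUBLISHED inputs + the four DS stubs (planner RULING L38 (2))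

Cell `bsd-eis`, seat `bsd-eis-k5-c2` (registrar of halves v4, L38 (2)(b)). Successor of
`EisensteinPrimesGoodLatticeMuLambdaSplitDS.lean` (p490449: the same composition at every `K` with
`p ∤ h_K`), now with the h_K-free shapes of `X1/KellerYinMuLambdaSplitDSFree.lean` so that the conclusion
is LITERALLY the registered stub `∀ W p, X1.KellerYinHalves.GoodLatticeMuLambdaOnTree W p` (Keller–Yin
Thm. 3.0.8 carries no class-number hypothesis; the h_K-free Rubin input is Bleher et al. 2020 Thm. 3.3.1
+ Greenberg 2016 Prop. 4.1.1, planner L35/L36).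

* `goodLatticeMuLambdaOnTree_of_splitDSFree` — the composition (proof = p490449's, minus `hh`).
* `goodLatticeBDPValue_of_published_of_splitDSFree` — the crux by name from Castella–Hsieh, Carayol,
  CGLS 4.2.2-div, CGLS 5.1.3 (PUB) + [ALG], [AN]-DS-Free, [BRω]-DS-Free, [BR𝟙]-DS-Free — the
  composition line of the skeleton `halves.v4`.

HONEST FRAMING: CONDITIONAL on named inputs; [BR𝟙]-DS-Free is a THEOREM only at `K` with `p ∤ h_K`
today (`charMainConjOnTreeDS_of_four_facts` + `charMainConjOnTreeDS_of_free` go the other way); its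
class-wide kernel proof waits on the typer's p491869 (BCGKPST) and Greenberg 2016 Prop. 4.1.1. Nothing
booked; no label moves; nothing about BSD beyond conditional statements. Helper attached to
stmt-BirchSwinnertonDyer-19032.
-/

set_option autoImplicit false
set_option linter.dupNamespace false

noncomputable section

open scoped Classical

open PowerSeries WeierstrassCurve NumberField IsDedekindDomain Field Rat.HeightOneSpectrum
  Literature.NumberTheory.EllipticCurves Literature.NumberTheory.EllipticCurves.ModularForms
  Literature.NumberTheory.QuadraticFields Literature.NumberTheory.EllipticCurves.Rank1Residual
  Literature.NumberTheory.EllipticCurves.Castella2018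
  Literature.NumberTheory.EllipticCurves.CastellaGrossiLeeSkinner2022
  Literature.NumberTheory.EllipticCurves.KellerYin2024
  Literature.NumberTheory.EllipticCurves.GreenbergVatsal2000
  Literature.NumberTheory.EllipticCurves.IwasawaAlgebra
  Literature.NumberTheory.GaloisRepresentations

namespace Summit.BirchSwinnertonDyer.BirchSwinnertonDyer.Theorems.EisensteinPrimesMuLambda

open Summit.BirchSwinnertonDyer.Rank1Residual.X11b.Halves
  Summit.BirchSwinnertonDyer.Rank1Residual.X1.KellerYinHalves
  Summit.BirchSwinnertonDyer.Rank1Residual.X1.KellerYinMuLambdaSplit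
  Summit.BirchSwinnertonDyer.Rank1Residual.X1.KellerYinMuLambdaSplitDS
  Summit.BirchSwinnertonDyer.Rank1Residual.X1.KellerYinMuLambdaSplitDSFree

section ComposeFree

/-- **THE CLASS-WIDE RE-CUT COMPOSITION: the registered stub `∀ W p, GoodLatticeMuLambdaOnTree W p`
of the line `halves` from `[ALG]` + `[AN]-DS-Free` + `[BRω]-DS-Free` + `[BR𝟙]-DS-Free`** (planner
RULINGS L30 (S3) / L38 (2): one analytic frame, no class-number binder, no Katz-existence input).
Proof = `goodLatticeMuLambda_of_splitDS` (p490449) with the binder `¬ p ∣ h_K` gone: [BR𝟙]-DS-Free at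
`𝟙̃` produces the de Shalit datum and `λ(𝔛_𝟙̃) = n₁ + [𝟙̃|_K = 𝟙]`, [BRω]-DS-Free and [AN]-DS-Free
consume it, [ALG] and `lambda_eq_of_alg_of_an_of_bridge` cancel the local sums, the Weierstrass
dictionary concludes. CONDITIONAL on the four named inputs ([ALG] Keller–Yin Thm. 1.5.1 PRE;
[AN]-DS-Free KY Thm. 2.2.2 PRE in DS currency; [BRω]-DS-Free PRE pending road R-ψ; [BR𝟙]-DS-Free = the
h_K-free re-run of p484379 on Bleher et al. 2020 Thm. 3.3.1 + Greenberg 2016 Prop. 4.1.1, pending the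
typer's p491869); nothing booked; no label moves. [claim: KellerYin2024, status: under-review]
[cite: KellerYin2024, Thm. 1.5.1, Thm. 1.2.2, Thms. 2.2.1–2.2.3, proof of Thm. 3.0.8 (arXiv:2402.12781v2 TeX L1631–1640)]
[cite: CastellaGrossiLeeSkinner2022, Thm. 2.2.1–2.2.2 with (2.16)] [cite: BleherEtAl2020, §3.3 Thm. 3.3.1] -/
theorem goodLatticeMuLambdaOnTree_of_splitDSFree
    (halg : thm151_algmain_goodLattice_OPEN)
    (han : ∀ (W : WeierstrassCurve ℚ) [W.IsElliptic] [W.IsGloballyMinimal] (p : ℕ) [Fact p.Prime],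
      GoodLatticeAnalyticSideDSOnTreeFree W p)
    (hω : ∀ (W : WeierstrassCurve ℚ) [W.IsElliptic] [W.IsGloballyMinimal] (p : ℕ) [Fact p.Prime],
      GoodLatticeOmegaSideDSOnTreeFree W p)
    (hbr : ∀ (p : ℕ) [Fact p.Prime], CharMainConjOnTreeDSFree p)
    (W : WeierstrassCurve ℚ) [W.IsElliptic] [W.IsGloballyMinimal] (p : ℕ) [Fact p.Prime] :
    GoodLatticeMuLambdaOnTree W p := by
  intro hp hgood hred hanom hGL K _ _ hK hHN hHp hodd h3 hEK _ ι v vbar hv hvbar hne κ hκ γ hγ N _ Dt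
    _ _ _ _ ι' hι' ΩK Ωp L hΩK hL F hF
  -- §1: the Teichmüller pair over `ℚ`, its restriction to `K`, the bad set
  obtain ⟨Φ, hΦ, θsub, θquot, hsub, hquot⟩ := exists_teichmullerPair W p hred
  have hpair : IsResidualPairOver (W.baseChange K) p (θsub.restrictField K) (θquot.restrictField K) :=
    isResidualPairOver_restrictField W p K hΦ hsub hquot
  have hN0 : W.conductorNorm ℤ ≠ 0 := (W.conductorNorm_pos_holds).ne'
  obtain ⟨Sf, hSf⟩ := exists_finset_places_dvd (K := K) (N := W.conductorNorm ℤ) hN0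
  -- §2: `𝟙̃` is Teichmüller, unramified away from `N` (Néron–Ogg–Shafarevich + [LOCp]) and at `p`
  have hT1 : ∀ σ : absoluteGaloisGroup ℚ, θquot σ ^ (p - 1) = 1 := hquot.1
  have hT1K : ∀ σ : absoluteGaloisGroup K, θquot.restrictField K σ ^ (p - 1) = 1 := fun σ ↦ hT1 _
  have hcardΦ : Nat.card (Φ.map (geomTorsion W (p : ℤ)).subtype) = p := by
    rw [Nat.card_congr (Φ.equivMapOfInjective (geomTorsion W (p : ℤ)).subtype
      (geomTorsion W (p : ℤ)).subtype_injective).toEquiv.symm, hΦ.1]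
  have hunrp : ∀ u : HeightOneSpectrum (𝓞 ℚ), ((p : ℕ) : 𝓞 ℚ) ∈ u.asIdeal → θquot.IsUnramifiedAt u :=
    goodLatticeQuotCharUnramifiedAtPOnTree_holds W p hp hgood hred hanom hGL Φ hΦ θquot hquot
  have hunr : ∀ u : HeightOneSpectrum (𝓞 ℚ), ((W.conductorNorm ℤ : ℤ) : 𝓞 ℚ) ∉ u.asIdeal →
      θquot.IsUnramifiedAt u := by
    intro u hu
    by_cases hpu : ((p : ℕ) : 𝓞 ℚ) ∈ u.asIdeal
    · exact hunrp u hpu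
    · exact isUnramifiedAt_of_isTeichmullerLiftOnQuot W ∅ hcardΦ hquot
        (hasGoodReductionAt_of_conductorNorm_notMem W u hu) hpu
  -- §3: the Hecke character `θ_K` of `𝟙̃|_K` (Artin reciprocity)
  obtain ⟨θK, -, hθK'⟩ := exists_heckeCharacter_of_pow_eq_one ∅ ι' (θquot.restrictField K) hT1K
  have hθK : IsHeckeCharOf ι' (θquot.restrictField K) θK := hθK'
  -- §4: the dual data of the two character Selmer groups (exist unconditionally, p414770)
  obtain ⟨Dsub⟩ := nonempty_unrDualData_char (∅ : Set (PadicAlgCl p)) (θsub.restrictField K) κ vbar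
    (∅ : Set (HeightOneSpectrum (𝓞 K))) hγ.out
  obtain ⟨Dquot⟩ := nonempty_unrDualData_char (∅ : Set (PadicAlgCl p)) (θquot.restrictField K) κ vbar
    (∅ : Set (HeightOneSpectrum (𝓞 K))) hγ.out
  -- §5: [BR𝟙]-DS-Free at `𝟙̃` PRODUCES the de Shalit datum and `λ(𝔛_𝟙̃) = n₁ + [𝟙̃|_K = 𝟙]`
  obtain ⟨-, -, -, S, κ', γ', Ω, δ, Ωp₂, G, g, hS, hgen, hΩ, hδ, hG, hJ, hg0, hlam1⟩ :=
    hbr p hp K hK hHp hodd h3 ι v vbar hv hvbar hne κ hκ γ ι' hι' θquot hT1 (W.conductorNorm ℤ) hN0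
      hHN hunr hunrp θK hθK Dquot
  -- §6: [BRω]-DS-Free at `ω̃` CONSUMES it: `λ(𝔛_ω̃) = n₁`
  obtain ⟨-, -, -, hlamω⟩ := hω W p hp hgood hred hanom hGL K hK hHN hHp hodd h3 hEK ι v vbar hv
    hvbar hne κ hκ γ ι' hι' Φ hΦ θsub θquot hsub hquot θK hθK S hS κ' γ' hgen Ω δ Ωp₂ G g hΩ hδ hG hJ
    hg0 Dsub
  -- §7: [ALG]
  obtain ⟨hXfin, hXtors, hXmu, hXlam⟩ := halg W p hp hgood hred hanom hGL K hK hHN hHp hEK ι v vbar hv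
    hvbar hne κ hκ γ (θsub.restrictField K) (θquot.restrictField K) hpair Sf hSf Dsub Dquot
  -- §8: [AN]-DS-Free CONSUMES the datum: `λ(𝓛) + Σ = 2n₁ + Σ'`
  obtain ⟨m, hm, hman⟩ := han W p hp hgood hred hanom hGL K hK hHN hHp hodd h3 hEK ι v vbar hv
    hvbar hne κ hκ γ N Dt ι' hι' ΩK Ωp L hΩK hL (θsub.restrictField K) (θquot.restrictField K) hpair Sf
    hSf θK hθK S hS κ' γ' hgen Ω δ Ωp₂ G g hΩ hδ hG hJ hg0
  -- §9: bookkeeping: `λ(𝔛) = m` (the local sums cancel)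
  have hlamX : lambdaInvariant p (AcSelmer.XAc (W.baseChange K) p κ vbar ∅ γ) = m :=
    lambda_eq_of_alg_of_an_of_bridge hXlam hman hlamω hlam1
  -- §10: the Weierstrass dictionary on the generator `F`
  haveI := hXfin
  have hFU := firstUnitCoeff_map_toUnr_of_charIdeal_eq_span
    (AcSelmer.XAc (W.baseChange K) p κ vbar ∅ γ) hXtors hXmu (F := F) hF
  rw [hlamX] at hFU
  exact ⟨m, hFU, (firstUnitCoeffAt_iff L m).mp hm⟩

/-- **The crux BY NAME from FOUR PUBLISHED named inputs and the four class-wide DS stubs** (the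
composition of the line `halves` v4, planner RULING L38 (2)): Castella–Hsieh 2018 (BDP frame exists),
Carayol (level = conductor), CGLS 2022 proof of Thm. 4.2.2 first half (one divisibility), CGLS 2022
Thm. 5.1.3 (BDP value) — `KellerYinHalves.thm308_of_cgls_of_muLambda` (p411059) — with `stub_muLambda`
SUPPLIED by `goodLatticeMuLambdaOnTree_of_splitDSFree` from [ALG], [AN]-DS-Free, [BRω]-DS-Free,
[BR𝟙]-DS-Free. CONDITIONAL; nothing booked; no label moves. [claim: KellerYin2024, status: under-review]
[cite: KellerYin2024, Thm. 3.0.8 (IMC2), Thm. 1.5.1, Thm. 1.2.2, Thms. 2.2.1–2.2.3]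
[cite: CastellaGrossiLeeSkinner2022, proof of Thm. 4.2.2, Thm. 5.1.3] [cite: CastellaHsieh2018, Def. 3.7 and Prop. 3.8] -/
theorem goodLatticeBDPValue_of_published_of_splitDSFree
    (hCH : castellaHsieh2018_exists_isBDPLFunction)
    (hC : ∀ (N : ℕ) [NeZero N], IsNewformOf.level_eq_conductorNorm (N := N))
    (hdiv : proofThm422_exists_isBDPLFunction_isTorsion_charIdeal_dvd)
    (hval : thm513_exists_isBDPLFunction_valueAtOne)
    (halg : thm151_algmain_goodLattice_OPEN)
    (han : ∀ (W : WeierstrassCurve ℚ) [W.IsElliptic] [W.IsGloballyMinimal] (p : ℕ) [Fact p.Prime],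
      GoodLatticeAnalyticSideDSOnTreeFree W p)
    (hω : ∀ (W : WeierstrassCurve ℚ) [W.IsElliptic] [W.IsGloballyMinimal] (p : ℕ) [Fact p.Prime],
      GoodLatticeOmegaSideDSOnTreeFree W p)
    (hbr : ∀ (p : ℕ) [Fact p.Prime], CharMainConjOnTreeDSFree p) :
    Summit.BirchSwinnertonDyer.BirchSwinnertonDyer.Theses.EisensteinPrimes.GoodLatticeBDPValue := by
  unfold Summit.BirchSwinnertonDyer.BirchSwinnertonDyer.Theses.EisensteinPrimes.GoodLatticeBDPValue
  exact thm308_of_cgls_of_muLambda hCH hC hdiv hval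
    (fun W _ _ p _ ↦ goodLatticeMuLambdaOnTree_of_splitDSFree halg han hω hbr W p)

end ComposeFree

end Summit.BirchSwinnertonDyer.BirchSwinnertonDyer.Theorems.EisensteinPrimesMuLambda

end
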